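import Literature.Computability.QuantumComplexity.JonesLocalGateCircuit
import Literature.Computability.QuantumComplexity.CondGate
import Literature.Computability.QuantumComplexity.ForrelationThm25Amplitude
import HarnessLib

/-!
# The controlled AJL local gate as a product of five gadget targets

Topic `Literature/Computability/QuantumComplexity`; a step in the discharge of
`ajl_jonesApproxProblem_mem_PromiseBQP`. In the circuit, a letter `σᵢ^{±}` of the braid word is the
local core `ajlLocalCore ±` placed on the three vertex registers `e : Fin 6 ↪ Fin N` and applied
*conditionally* on the labels with the Hadamard-test qubit `q` and the table bit `w` both set
(AJL Claim 4.1 with a one-hot letter table): `condOn (Sqw q w) (placeGate e (ajlLocalCore ±))`.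
By `ajlLocalCore_eq_conj` this is the product of five *gadget targets* — label-controlled one-qubit
rotations of the high middle bit `e 2` and a label-dependent diagonal phase — each of the exact form
delivered by `rotGadget_implOn_gen` / `phaseGadget_implOn_gen`:

* `tgtRot e q w z sgn` (`z = 2, 3`; `sgn = 1` for `G_z`, `−1` for `G_zᴴ = G_zᵀ`), `tgtPhase e q w ±`;
* `tgtRot_eq_condOn`, `tgtRotH_eq_condOn`, `tgtPhase_eq_condOn`;
* **`letterTargets_prod`**: `tgtRot 2 · tgtRot 3 · tgtPhase · tgtRot 3ᴴ · tgtRot 2ᴴ = condOn (Sqw q w) (placeGate e (ajlLocalCore ±))`.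

## References

* D. Aharonov, V. Jones, Z. Landau, Algorithmica 55 (2009), Claim 4.1 [AharonovJonesLandau2009].
-/

noncomputable section

namespace Literature.Computability.QuantumComplexity

open _root_.Matrix Finset Cryptography

variable {N : ℕ}

/-! ### The adjoint of a real rotation block -/

/-- `[[a, −b], [b, a]]ᴴ = [[a, b], [−b, a]]`. [folklore] -/
theorem rot2x2_conjTranspose (a b : ℝ) : (rot2x2 a b)ᴴ = rot2x2 a (-b) := by
  ext x y
  rw [Matrix.conjTranspose_apply, rot2x2_apply, rot2x2_apply]
  rw [qreg_one_eq x, qreg_one_eq y]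
  cases x 0 <;> cases y 0 <;> simp [Complex.conj_ofReal]

/-- The adjoint of a rotation block. [folklore] -/
theorem rotBlock_conjTranspose (z : ℤ) (cnd : QReg 6 → Prop) [DecidablePred cnd] (w : QReg 6) :
    (rotBlock z cnd w)ᴴ = if cnd w then rot2x2 (rotAmpA z) (-rotAmpB z) else 1 := by
  unfold rotBlock; split_ifs
  · exact rot2x2_conjTranspose _ _
  · exact Matrix.conjTranspose_one

/-- Entries of `rot2x2` in the diagonal/off-diagonal form used by `rotSign_entry_bound`. [folklore] -/
theorem rot2x2_apply_eq (a b : ℝ) (x y : QReg 1) :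
    rot2x2 a b x y = if x 0 = y 0 then (a : ℂ) else if x 0 = true then (b : ℂ) else ((-b : ℝ) : ℂ) := by
  rw [rot2x2_apply]; cases x 0 <;> cases y 0 <;> simp

/-! ### The control set and the five targets -/

/-- The labels with the Hadamard-test qubit `q` and the table bit `w` both set. [cite: AharonovJonesLandau2009, Claim 4.1] -/
def Sqw (q w : Fin N) : Set (QReg N) := {z | z q = true ∧ z w = true}

/-- Membership in `Sqw`. [folklore] -/
@[simp] theorem mem_Sqw {q w : Fin N} {z : QReg N} : z ∈ Sqw q w ↔ z q = true ∧ z w = true := Iff.rfl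

/-- Membership in `Sqw` is decidable. [folklore] -/
instance (q w : Fin N) : DecidablePred (· ∈ Sqw q w) := fun z => by simp only [mem_Sqw]; infer_instance

variable (e : Fin 6 ↪ Fin N) (q w : Fin N)

/-- **The rotation targets**: the high middle bit `e 2` rotated by `G_z` (`sgn = 1`) or its adjoint
(`sgn = −1`) on the labels of `Sqw q w` satisfying `Cond_z`. [cite: AharonovJonesLandau2009, Claim 4.1] -/
def tgtRot (z : ℤ) (cnd : QReg 6 → Prop) [DecidablePred cnd] (sgn : ℝ) : Matrix (QReg N) (QReg N) ℂ :=
  ctrlGate (e 2) fun x => if x ∈ Sqw q w ∧ cnd (x ∘ e) then rot2x2 (rotAmpA z) (sgn * rotAmpB z) else 1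

/-- **The phase target**: `c_±` on the labels of `Sqw q w` satisfying `ECond`. [cite: AharonovJonesLandau2009, Claim 4.1] -/
def tgtPhase (positive : Bool) : Matrix (QReg N) (QReg N) ℂ :=
  Matrix.diagonal fun x => if x ∈ Sqw q w ∧ ECond (x ∘ e) then ajlPhaseConst positive else 1

variable {e q w} (hq : q ∉ Set.range e) (hw : w ∉ Set.range e)
include hq hw

/-- Membership in `Sqw` does not depend on the local wires. [folklore] -/
theorem Sqw_update (x : QReg N) (j : Fin 6) (b : Bool) : Function.update x (e j) b ∈ Sqw q w ↔ x ∈ Sqw q w := by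
  simp only [mem_Sqw]
  rw [Function.update_of_ne (fun h => hq ⟨j, h.symm⟩), Function.update_of_ne (fun h => hw ⟨j, h.symm⟩)]

/-- Membership in `Sqw` only depends on wires off the range of `e`. [folklore] -/
theorem Sqw_agree (x y : QReg N) (h : ∀ i, i ∉ Set.range e → x i = y i) : x ∈ Sqw q w ↔ y ∈ Sqw q w := by
  simp only [mem_Sqw]; rw [h q hq, h w hw]

/-- Placed local matrices commute with the projection onto `Sqw`. [folklore] -/
theorem placeGate_comm_projOn_Sqw (A : Matrix (QReg 6) (QReg 6) ℂ) :
    placeGate e A * projOn (Sqw q w) = projOn (Sqw q w) * placeGate e A :=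
  placeGate_mul_projOn_comm e (Sqw_agree hq hw) A

/-- **The rotation target is the conditioned placed rotation.** [cite: AharonovJonesLandau2009, Claim 4.1] -/
theorem tgtRot_eq_condOn (z : ℤ) (cnd : QReg 6 → Prop) [DecidablePred cnd] :
    tgtRot e q w z cnd 1 = condOn (Sqw q w) (placeGate e (ctrlGate 2 (rotBlock z cnd))) := by
  rw [placeGate_ctrlGate, condOn_ctrlGate (Sqw_update hq hw · 2 ·), tgtRot]
  congr 1; funext x
  unfold rotBlock
  by_cases h1 : x ∈ Sqw q w <;> by_cases h2 : cnd (x ∘ e) <;> simp [h1, h2]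

/-- **The adjoint rotation target is the conditioned placed adjoint rotation** (conditions not
reading the rotated bit). [cite: AharonovJonesLandau2009, Claim 4.1] -/
theorem tgtRotH_eq_condOn (z : ℤ) (cnd : QReg 6 → Prop) [DecidablePred cnd] (hcnd : ∀ x b, cnd (Function.update x 2 b) ↔ cnd x) :
    tgtRot e q w z cnd (-1) = condOn (Sqw q w) (placeGate e (ctrlGate 2 (rotBlock z cnd))ᴴ) := by
  rw [ctrlGate_conjTranspose 2 (fun x b => by unfold rotBlock; exact if_congr (hcnd x b) rfl rfl), placeGate_ctrlGate,
    condOn_ctrlGate (Sqw_update hq hw · 2 ·), tgtRot]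
  congr 1; funext x
  rw [rotBlock_conjTranspose]
  by_cases h1 : x ∈ Sqw q w <;> by_cases h2 : cnd (x ∘ e) <;> simp [h1, h2]

omit hq hw in
/-- **The phase target is the conditioned placed phase.** [cite: AharonovJonesLandau2009, Claim 4.1] -/
theorem tgtPhase_eq_condOn (positive : Bool) :
    tgtPhase e q w positive = condOn (Sqw q w) (placeGate e (ajlPhaseDiag (ajlPhaseConst positive))) := by
  rw [ajlPhaseDiag, placeGate_diagonal, condOn_diagonal, tgtPhase]
  congr 1; funext x
  by_cases h1 : x ∈ Sqw q w <;> by_cases h2 : ECond (x ∘ e) <;> simp [h1, h2]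

/-- **The five targets multiply to the conditioned local core.** [cite: AharonovJonesLandau2009, Claim 4.1 and Claim 2.6] -/
theorem letterTargets_prod (positive : Bool) :
    tgtRot e q w 2 Cond₂ 1 * tgtRot e q w 3 Cond₃ 1 * tgtPhase e q w positive * tgtRot e q w 3 Cond₃ (-1) * tgtRot e q w 2 Cond₂ (-1) =
      condOn (Sqw q w) (placeGate e (ajlLocalCore positive)) := by
  rw [tgtRot_eq_condOn hq hw, tgtRot_eq_condOn hq hw, tgtPhase_eq_condOn, tgtRotH_eq_condOn hq hw 3 Cond₃ cond₃_update,
    tgtRotH_eq_condOn hq hw 2 Cond₂ cond₂_update]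
  have hc := placeGate_comm_projOn_Sqw hq hw (e := e)
  rw [condOn_mul _ (hc _), condOn_mul _ (by rw [← placeGate_mul_holds]; exact hc _),
    condOn_mul _ (by rw [← placeGate_mul_holds, ← placeGate_mul_holds]; exact hc _),
    condOn_mul _ (by rw [← placeGate_mul_holds, ← placeGate_mul_holds, ← placeGate_mul_holds]; exact hc _)]
  rw [← placeGate_mul_holds, ← placeGate_mul_holds, ← placeGate_mul_holds, ← placeGate_mul_holds, ajlLocalCore_eq_conj, ajlF,
    Matrix.conjTranspose_mul]
  unfold ajlRot2 ajlRot3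
  simp only [Matrix.mul_assoc]

end Literature.Computability.QuantumComplexity

end
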